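import Mathlib
import Literature.Analysis.TotalPositivity.MultiplyPositiveProofs

/-!
# LINE `valuative_door` (crux `WeakLifting`, stmt-ValiantsHypothesis-19561) — FIRST HELPER FILE of the pen's prover plan
# `Cruxes/WeakLifting/Lines/valuative_door-plan-rankone.md` (val-idea-24 g3): the RANK-ONE PENCIL EXPANSION (steps 1–3) and
# «dominant ⇒ unique strict log-maximiser» (step 5, one direction)

HONEST FRAMING.  Helper lemmas (cell `pub-symmetroid`, seat val-sym-lift-p1 g21, 2026-08-29; `--supports 19561 --as helper`) toward the
line's first `Theorems/…` CALIBRATION TARGET `ValRankOneSharpModularDiss` (skeleton `Cruxes/WeakLifting/Lines/valuative_door.lean` rev 2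
@84c5f76c6d22, NOT importable from `Theorems/`, so everything here is def-free and stated on the raw expressions).  Nothing here is a stub
of the line, nothing closes on the ledger, and nothing bears on `WeakLifting` / `TropicalB` in their windows, on the valuative candidates
vW / vU / vB / `ValRankOneLaw`, on `MatrixDescartes` (stmt-ValiantsHypothesis-18050) or on VP ≠ VNP.
ARCHIMEDEAN PRECEDENT (crit-6 READ #150): `Theorems/LacunarySymmetroidMatrixDescartesCensusPivotGramExpansion.lean`
(`GramExpansion.det_gramPencil` / `coeff_det_gramPencil`, over `ℝ`, weights `C sg * X ^ ex`, the V1 pivot census) — §1–§3 below are its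
FIELD-GENERIC re-proof in the door's term shape (the valuation `v` lives on an arbitrary field `F`), not a restatement of it.

WHAT IS PROVED (over any field `F`; §3 needs nothing more; §4 for any absolute value `v : AbsoluteValue F ℝ`):
* §1 `rankOnePencil_eq_mul_diagonal_mul_transpose` — the rank-one lacunary pencil `Σ_l X^{d l} • (ε l • u_l u_lᵀ)` (as a matrix over
  `F[X]`) is `A · diagonal w · Aᵀ` with `A i l = C (u l i)` and `w l = C (ε l) · X^{d l}` (plan step 1).
* §2 `det_rankOnePencil` — by the tree's Cauchy–Binet `Literature.Analysis.TotalPositivity.det_mul_eq_sum_strictMono`: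
  `det = Σ_{t : Fin m → Fin K strictly monotone} C ((Π_i ε (t i)) · δ_t ^ 2) · X ^ (Σ_i d (t i))`, `δ_t = det (of fun i j => u (t j) i)`
  (plan step 2; the minor convention `of fun i j => u (g j) i` is the skeleton's).
* §3 `coeff_det_rankOnePencil` — under DISSOCIATION of `d` on strictly monotone selections (distinct `m`-subset sums), the coefficient of
  `X ^ (Σ_i d (t i))` is `(Π_i ε (t i)) · δ_t ^ 2`, and `coeff_det_rankOnePencil_eq_zero` — every exponent that is not a subset sum has
  coefficient `0` (plan step 3).
* §4 `dominant_iff_log` — for `E` in the support and `r > 0`: the strict domination `v (coeff E') · r^E' < v (coeff E) · r^E` for all other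
  support exponents `E'` (the summand condition of the skeleton's `domCount`) is EQUIVALENT to `E` being the unique strict maximiser of
  `E' ↦ log (v (coeff E')) + E' · log r` on the support — the «dominant ⇒ unique parametric optimiser» bridge of plan step 5 (both
  directions, elementary: `log` is strictly monotone on the positive reals).
Steps 6–7 of the plan (m-smallest lines, the rank potential Φ) are NOT here.  [folklore: Cauchy–Binet; everything else bookkeeping]
-/

-- `Summit.ValiantsHypothesis.ValiantsHypothesis.…` repeats a component by the D-0017 layout
-- (single-conjunct summit), which the `dupNamespace` linter flags; the name is mandated.
set_option linter.dupNamespace false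
set_option autoImplicit false

namespace Summit.ValiantsHypothesis.ValiantsHypothesis.Theorems.KPlusLogSqLaw.ValDoor

open Polynomial Finset Matrix
open scoped BigOperators

section Expansion

variable {F : Type*} [Field F]

/-! ## §1 The factorisation `A · diagonal w · Aᵀ` -/

/-- **Plan step 1.**  The rank-one lacunary pencil as a product `A · diagonal w · Aᵀ` over `F[X]`. [bookkeeping] -/
theorem rankOnePencil_eq_mul_diagonal_mul_transpose (m K : ℕ) (d : Fin K → ℕ) (ε : Fin K → F) (u : Fin K → Fin m → F) :
    (∑ l, ((X : F[X]) ^ d l) • (ε l • Matrix.vecMulVec (u l) (u l)).map (C : F →+* F[X]))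
      = (Matrix.of fun (i : Fin m) (l : Fin K) => C (u l i)) * Matrix.diagonal (fun l => C (ε l) * X ^ d l)
        * (Matrix.of fun (i : Fin m) (l : Fin K) => C (u l i))ᵀ := by
  refine Matrix.ext fun i j => ?_
  have lhs : (∑ l, ((X : F[X]) ^ d l) • (ε l • Matrix.vecMulVec (u l) (u l)).map (C : F →+* F[X])) i j
      = ∑ l, (X : F[X]) ^ d l * (C (ε l) * (C (u l i) * C (u l j))) := by
    rw [Matrix.sum_apply]
    refine Finset.sum_congr rfl fun l _ => ?_
    simp only [Matrix.smul_apply, Matrix.map_apply, Matrix.vecMulVec_apply, smul_eq_mul, map_mul]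
  have rhs : ((Matrix.of fun (i : Fin m) (l : Fin K) => C (u l i)) * Matrix.diagonal (fun l => C (ε l) * X ^ d l)
        * (Matrix.of fun (i : Fin m) (l : Fin K) => C (u l i))ᵀ : Matrix (Fin m) (Fin m) F[X]) i j
      = ∑ l, C (u l i) * ((C (ε l) * X ^ d l) * C (u l j)) := by
    rw [Matrix.mul_assoc, Matrix.mul_apply]
    refine Finset.sum_congr rfl fun l _ => ?_
    rw [Matrix.diagonal_mul, Matrix.transpose_apply, Matrix.of_apply, Matrix.of_apply]
  rw [lhs, rhs]
  exact Finset.sum_congr rfl fun l _ => by ring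

/-! ## §2 Cauchy–Binet expansion of the determinant -/

/-- the row selection of the diagonal-times-transpose factor is again diagonal-times-transpose. [bookkeeping] -/
theorem submatrix_diagonal_mul_transpose {m K : ℕ} (A : Matrix (Fin m) (Fin K) F[X]) (w : Fin K → F[X]) (t : Fin m → Fin K) :
    (Matrix.diagonal w * Aᵀ).submatrix t id = Matrix.diagonal (w ∘ t) * (A.submatrix id t)ᵀ := by
  refine Matrix.ext fun i j => ?_
  simp [Matrix.submatrix_apply, Matrix.diagonal_mul, Matrix.transpose_apply]

/-- the selected minor of `A = (C (u l i))` is `C` of the scalar minor `det (of fun i j => u (t j) i)`. [bookkeeping] -/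
theorem det_submatrix_C {m K : ℕ} (u : Fin K → Fin m → F) (t : Fin m → Fin K) :
    ((Matrix.of fun (i : Fin m) (l : Fin K) => C (u l i)).submatrix id t).det
      = C (Matrix.det (Matrix.of fun i j => u (t j) i)) := by
  have h : (Matrix.of fun (i : Fin m) (l : Fin K) => C (u l i)).submatrix id t
      = (C : F →+* F[X]).mapMatrix (Matrix.of fun i j => u (t j) i) := by
    refine Matrix.ext fun i j => ?_
    simp [Matrix.submatrix_apply, RingHom.mapMatrix_apply, Matrix.map_apply]
  rw [h, ← RingHom.map_det]

open scoped Classical in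
/-- **Plan step 2 — the rank-one expansion.**  `det (Σ_l X^{d l} ε_l u_l u_lᵀ) = Σ_{t strictly monotone} C (ε_t · δ_t²) · X^{E t}`
with `ε_t = Π_i ε (t i)`, `δ_t = det (of fun i j => u (t j) i)`, `E t = Σ_i d (t i)`. [folklore: Cauchy–Binet] -/
theorem det_rankOnePencil (m K : ℕ) (d : Fin K → ℕ) (ε : Fin K → F) (u : Fin K → Fin m → F) :
    Matrix.det (∑ l, ((X : F[X]) ^ d l) • (ε l • Matrix.vecMulVec (u l) (u l)).map (C : F →+* F[X]))
      = ∑ t ∈ (univ : Finset (Fin m → Fin K)).filter (fun t => StrictMono t),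
          C ((∏ i, ε (t i)) * (Matrix.det (Matrix.of fun i j => u (t j) i)) ^ 2) * X ^ (∑ i, d (t i)) := by
  set A : Matrix (Fin m) (Fin K) F[X] := Matrix.of fun (i : Fin m) (l : Fin K) => C (u l i) with hA
  set w : Fin K → F[X] := fun l => C (ε l) * X ^ d l with hw
  rw [rankOnePencil_eq_mul_diagonal_mul_transpose, ← hA, ← hw, Matrix.mul_assoc,
    Literature.Analysis.TotalPositivity.det_mul_eq_sum_strictMono A (Matrix.diagonal w * Aᵀ)]
  refine Finset.sum_congr rfl fun t _ => ?_
  rw [submatrix_diagonal_mul_transpose, Matrix.det_mul, Matrix.det_diagonal, Matrix.det_transpose, hA,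
    det_submatrix_C]
  have hprod : ∏ i, (w ∘ t) i = C (∏ i, ε (t i)) * X ^ (∑ i, d (t i)) := by
    simp only [Function.comp, hw]
    rw [Finset.prod_mul_distrib, map_prod, Finset.prod_pow_eq_pow_sum]
  rw [hprod, map_mul, map_pow]
  ring

/-! ## §3 Coefficients under dissociation -/

open scoped Classical in
/-- **Plan step 3 (the subset-sum exponent).**  If the subset sums `Σ_i d (t i)` of strictly monotone selections are pairwise distinct
(DISSOCIATION), the coefficient of `X ^ (Σ_i d (t₀ i))` in the rank-one determinant is `ε_{t₀} · δ_{t₀}²`. [bookkeeping] -/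
theorem coeff_det_rankOnePencil (m K : ℕ) (d : Fin K → ℕ) (ε : Fin K → F) (u : Fin K → Fin m → F)
    (hdiss : ∀ t t' : Fin m → Fin K, StrictMono t → StrictMono t' → ∑ i, d (t i) = ∑ i, d (t' i) → t = t')
    (t₀ : Fin m → Fin K) (ht₀ : StrictMono t₀) :
    (Matrix.det (∑ l, ((X : F[X]) ^ d l) • (ε l • Matrix.vecMulVec (u l) (u l)).map (C : F →+* F[X]))).coeff (∑ i, d (t₀ i))
      = (∏ i, ε (t₀ i)) * (Matrix.det (Matrix.of fun i j => u (t₀ j) i)) ^ 2 := by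
  rw [det_rankOnePencil, Polynomial.finsetSum_coeff]
  rw [Finset.sum_eq_single t₀]
  · rw [Polynomial.coeff_C_mul_X_pow, if_pos rfl]
  · intro t ht hne
    rw [Polynomial.coeff_C_mul_X_pow, if_neg]
    intro h
    exact hne (hdiss t t₀ (Finset.mem_filter.1 ht).2 ht₀ h.symm)
  · intro h
    exact absurd (Finset.mem_filter.2 ⟨Finset.mem_univ _, ht₀⟩) h

open scoped Classical in
/-- **Plan step 3 (other exponents).**  An exponent that is NOT a subset sum of a strictly monotone selection has coefficient `0`. [bookkeeping] -/
theorem coeff_det_rankOnePencil_eq_zero (m K : ℕ) (d : Fin K → ℕ) (ε : Fin K → F) (u : Fin K → Fin m → F) (n : ℕ)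
    (hn : ∀ t : Fin m → Fin K, StrictMono t → ∑ i, d (t i) ≠ n) :
    (Matrix.det (∑ l, ((X : F[X]) ^ d l) • (ε l • Matrix.vecMulVec (u l) (u l)).map (C : F →+* F[X]))).coeff n = 0 := by
  rw [det_rankOnePencil, Polynomial.finsetSum_coeff]
  refine Finset.sum_eq_zero fun t ht => ?_
  rw [Polynomial.coeff_C_mul_X_pow, if_neg]
  intro h
  exact hn t (Finset.mem_filter.1 ht).2 h.symm

open scoped Classical in
/-- **Plan step 4 (valuations of the coefficients).**  Under dissociation, for any absolute value `v`:
`v (coeff (E t₀)) = (Π_i v (ε (t₀ i))) · v (δ_{t₀}) ^ 2`; in particular `= Π_i v (ε (t₀ i))` when the minor is a `v`-unit. [bookkeeping] -/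
theorem absoluteValue_coeff_det_rankOnePencil (m K : ℕ) (d : Fin K → ℕ) (ε : Fin K → F) (u : Fin K → Fin m → F)
    (hdiss : ∀ t t' : Fin m → Fin K, StrictMono t → StrictMono t' → ∑ i, d (t i) = ∑ i, d (t' i) → t = t')
    (t₀ : Fin m → Fin K) (ht₀ : StrictMono t₀) (v : AbsoluteValue F ℝ) :
    v ((Matrix.det (∑ l, ((X : F[X]) ^ d l) • (ε l • Matrix.vecMulVec (u l) (u l)).map (C : F →+* F[X]))).coeff (∑ i, d (t₀ i)))
      = (∏ i, v (ε (t₀ i))) * v (Matrix.det (Matrix.of fun i j => u (t₀ j) i)) ^ 2 := by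
  rw [coeff_det_rankOnePencil m K d ε u hdiss t₀ ht₀, map_mul, map_pow, map_prod]

open scoped Classical in
/-- unit minors: the coefficient valuation is the product of the letter valuations (plan step 4). [bookkeeping] -/
theorem absoluteValue_coeff_det_rankOnePencil_of_unit (m K : ℕ) (d : Fin K → ℕ) (ε : Fin K → F) (u : Fin K → Fin m → F)
    (hdiss : ∀ t t' : Fin m → Fin K, StrictMono t → StrictMono t' → ∑ i, d (t i) = ∑ i, d (t' i) → t = t')
    (t₀ : Fin m → Fin K) (ht₀ : StrictMono t₀) (v : AbsoluteValue F ℝ)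
    (hunit : v (Matrix.det (Matrix.of fun i j => u (t₀ j) i)) = 1) :
    v ((Matrix.det (∑ l, ((X : F[X]) ^ d l) • (ε l • Matrix.vecMulVec (u l) (u l)).map (C : F →+* F[X]))).coeff (∑ i, d (t₀ i)))
      = ∏ i, v (ε (t₀ i)) := by
  rw [absoluteValue_coeff_det_rankOnePencil m K d ε u hdiss t₀ ht₀ v, hunit, one_pow, mul_one]

end Expansion

/-! ## §4 Dominant exponents are unique strict log-maximisers (plan step 5) -/

section Dominance

variable {F : Type*} [Field F]

/-- positivity of `v` on support coefficients. [bookkeeping] -/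
theorem absoluteValue_coeff_pos (v : AbsoluteValue F ℝ) (f : F[X]) {E : ℕ} (hE : E ∈ f.support) : 0 < v (f.coeff E) :=
  v.pos (Polynomial.mem_support_iff.1 hE)

/-- one term: `v a · r^E' < v b · r^E ↔ log (v a) + E' log r < log (v b) + E log r` for positive data. [bookkeeping] -/
theorem mul_pow_lt_iff_log {a b r : ℝ} (ha : 0 < a) (hb : 0 < b) (hr : 0 < r) (E E' : ℕ) :
    a * r ^ E' < b * r ^ E ↔ Real.log a + E' * Real.log r < Real.log b + E * Real.log r := by
  have h1 : 0 < a * r ^ E' := mul_pos ha (pow_pos hr _)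
  have h2 : 0 < b * r ^ E := mul_pos hb (pow_pos hr _)
  rw [← Real.log_lt_log_iff h1 h2, Real.log_mul ha.ne' (pow_pos hr _).ne', Real.log_mul hb.ne' (pow_pos hr _).ne',
    Real.log_pow, Real.log_pow]

/-- **Plan step 5 (both directions).**  For `E` in the support of `f` and a radius `r > 0`: `E` strictly dominates every other support
term at radius `r` (the summand condition of the line's `domCount`) iff `E` is the unique strict maximiser of
`E' ↦ log (v (coeff E')) + E' · log r` over the support. [bookkeeping: `log` is strictly monotone] -/
theorem dominant_iff_log (v : AbsoluteValue F ℝ) (f : F[X]) {E : ℕ} (hE : E ∈ f.support) {r : ℝ} (hr : 0 < r) :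
    (∀ E' ∈ f.support, E' ≠ E → v (f.coeff E') * r ^ E' < v (f.coeff E) * r ^ E) ↔
    (∀ E' ∈ f.support, E' ≠ E →
      Real.log (v (f.coeff E')) + E' * Real.log r < Real.log (v (f.coeff E)) + E * Real.log r) := by
  constructor
  · intro h E' hE' hne
    exact (mul_pow_lt_iff_log (absoluteValue_coeff_pos v f hE') (absoluteValue_coeff_pos v f hE) hr E E').1 (h E' hE' hne)
  · intro h E' hE' hne
    exact (mul_pow_lt_iff_log (absoluteValue_coeff_pos v f hE') (absoluteValue_coeff_pos v f hE) hr E E').2 (h E' hE' hne)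

/-- the same with the parametric slope `s = log r` ranging over ALL reals (`r = exp s > 0`): an exponent is dominant at some radius iff it
is the unique strict maximiser of `log (v (coeff ·)) + s · (·)` for some real `s`. [bookkeeping] -/
theorem exists_dominant_iff_exists_slope (v : AbsoluteValue F ℝ) (f : F[X]) {E : ℕ} (hE : E ∈ f.support) :
    (∃ r : ℝ, 0 < r ∧ ∀ E' ∈ f.support, E' ≠ E → v (f.coeff E') * r ^ E' < v (f.coeff E) * r ^ E) ↔
    (∃ s : ℝ, ∀ E' ∈ f.support, E' ≠ E →
      Real.log (v (f.coeff E')) + E' * s < Real.log (v (f.coeff E)) + E * s) := by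
  constructor
  · rintro ⟨r, hr, h⟩
    exact ⟨Real.log r, (dominant_iff_log v f hE hr).1 h⟩
  · rintro ⟨s, h⟩
    refine ⟨Real.exp s, Real.exp_pos s, (dominant_iff_log v f hE (Real.exp_pos s)).2 ?_⟩
    simpa only [Real.log_exp] using h

end Dominance

end Summit.ValiantsHypothesis.ValiantsHypothesis.Theorems.KPlusLogSqLaw.ValDoor
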